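import Summits.QuantumFields.BalabanUV.Beta.WilsonReflectionContact2
import Summits.QuantumFields.BalabanUV.Beta.BorderedHessianStep
import Summits.QuantumFields.BalabanUV.Beta.SpineRecursiveParity
import Literature.MathematicalPhysics.QuantumFieldTheory.Balaban1983to89.Beta.HessKerRate

/-!
# `BalabanUV.Beta.WilsonLetterSocketFit` — binder row D1, W-side leaf (W-0W), stage S3d: **THE WILSON-SIDE HYPOTHESES OF THE ROW
# OWNER'S hR END, IN THEIR LITERAL SHAPE** (β sub-cell, row BETA-an3, lineage an3 gen 32)

HONEST FRAMING (cell charter, verbatim): «discharging BetaPertH makes Balaban's UV stability UNCONDITIONAL — a real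
constructive-QFT result; it is NOT the continuum limit and NOT the Clay problem.»  Neutral kernel algebra ([folklore]) on OUR tables; no
statement of Bałaban's papers, no `[cite:]`, no `Prop` fact; instantiates no binder of the wall.  NOT D1, NOT `BetaPertH`, NOT continuum,
NOT Clay.

PURPOSE.  The hR END for the recursive wall literal with the canonical second symbol,
`SpineRecursiveT2AllCanon.…_of_letters_canon` (p217427), takes the Wilson (2,2) letter at level `0` as the hypotheses (hWff) — stated
against the STEP Hessian `bhKStepAt d ρ L 0`, with the generator coefficients `(-(1 / 2 : ℝ))`, `(-(1 / 2 : ℝ)) ^ 2`, binder order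
`α κ u κ′ u′ x z β β′` and an additive residual slot `+ RW α κ u κ′ u′` — together with (hRWl)/(hRWr) (field support of `RW`), (hRWc)
(`LocStencil₂`) and (hRWp) (row-parity-odd).  This file states those five hypotheses IN THAT LITERAL SHAPE at the table
`T := (8N²)⁻¹ • wsym22 N` with the ZERO residual `RW := 0`, for every `d`, root `ρ` and window `L`, and proves them from S3c
(`WilsonReflectionContact2.wilsonW₂_bref_ff_canon_bhKAt`; `bhKStepAt_zero` is `rfl`) and the zero-kernel facts of the tree
(`HessKerRate.biLoc_zero`, `SpineRecursiveParity.parityOdd_zero`) — so that the wall instantiation discharges them BY NAME (`exact`, `d := 3`,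
`ρ := toSite (ctrOff 4 Lc)`, `L := Lc`).  Nothing else: no statement about the border or mixed letters, no assembly.
Provenance: β sub-cell, unit beta-an3 gen 32, 2026-08-20 (v1); no existing file touched.
-/

namespace Summit.QuantumFields.BalabanUV.Beta.WilsonLetterSocketFit

open Literature.MathematicalPhysics.QuantumFieldTheory.Balaban1983to89
open Literature.MathematicalPhysics.QuantumFieldTheory.Balaban1983to89.Beta
open ColourTrace (Complete TrOrthonormal)
open WilsonVertex2Sym (wsym22)
open WilsonBiStencil (wilsonW₂)
open StepJetData (wilsonA)
open ResolventReflection (bref Φ)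
open PolarizationSign (reflSign)
open KernelReflection (refK)
open ExpKernelCalculus (MKer BiLoc)
open OneStepResolventKernel (Fib)
open HessKerRate (biLoc_zero)
open BalabanCompositeJets (LocStencil₂)
open Summit.QuantumFields.BalabanUV.Beta.ChartConjugation (conjW)
open Summit.QuantumFields.BalabanUV.Beta.BorderedHessian (diagK ctGen bhKStepAt bhKStepAt_zero sgnK)
open Summit.QuantumFields.BalabanUV.Beta.TameKernelCalculus (trK)
open Summit.QuantumFields.BalabanUV.Beta.SpineRecursiveParity (parityOdd_zero)
open Summit.QuantumFields.BalabanUV.Beta.WilsonReflectionContact2 (wilsonW₂_bref_ff_canon_bhKAt)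

variable {d : ℕ} {N : ℕ} {C : Type*} [Fintype C] [DecidableEq C] {τ : C → Matrix (Fin N) (Fin N) ℂ}

/-! ## §1 (hWff): the Wilson (2,2) letter at level `0`, literal shape, zero residual -/

/-- [folklore] **(hWff) IN ITS LITERAL SHAPE, ZERO RESIDUAL.**  At the table `(8N²)⁻¹ • wsym22 N`, for every axis `α`, bonds `(κ,u)`,
`(κ′,u′)`, sites `x z` and field components `β β′`: the `ff` entry of the reflected Wilson bi-stencil equals the `ff` entry of
`(ε_κ ε_κ′) • refK (Φ L α) (Q + conjW (bhKStepAt d ρ L 0) (wilsonA κ u) (wilsonA κ′ u′) (diagK (−½·ĝ)) (diagK (−½·ĝ′)) (diagK ((−½)²·ĝ·ĝ′)) + 0)`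
with `ĝ = ctGen d α L κ u`, `ĝ′ = ctGen d α L κ′ u′` — binder order, coefficients and the residual slot EXACTLY as in the hypothesis
(hWff) of `SpineRecursiveT2AllCanon.…_of_letters_canon` (there `d = 3`, `ρ = toSite (ctrOff 4 Lc)`, `L = Lc`, `RW := 0`).  Proof:
`WilsonReflectionContact2.wilsonW₂_bref_ff_canon_bhKAt` (`bhKStepAt d ρ L 0 = bhKAt d ρ L` is `rfl`). -/
theorem wilsonW₂_letter_ff_canon_step (hτ : Complete τ) (ho : TrOrthonormal τ) (hN : N ≠ 0) (c : C) (ρ : Fin (d + 1) → ℤ)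
    (L : ℕ) [NeZero L] :
    ∀ (α κ : Fin (d + 1)) (u : Fin (d + 1) → ℤ) (κ' : Fin (d + 1)) (u' : Fin (d + 1) → ℤ) (x z : Fin (d + 1) → ℤ) (β β' : Fin (d + 1)),
      wilsonW₂ d ((8 * (N : ℝ) ^ 2)⁻¹ • wsym22 N) κ (bref α κ u) κ' (bref α κ' u') x z (Sum.inl β) (Sum.inl β') =
        ((reflSign α κ * reflSign α κ') • refK (Φ L α)
          (wilsonW₂ d ((8 * (N : ℝ) ^ 2)⁻¹ • wsym22 N) κ u κ' u' +
            conjW (bhKStepAt d ρ L 0) (wilsonA d κ u) (wilsonA d κ' u')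
              (diagK fun p c => (-(1 / 2 : ℝ)) * ctGen d α L κ u p c) (diagK fun p c => (-(1 / 2 : ℝ)) * ctGen d α L κ' u' p c)
              (diagK fun p c => (-(1 / 2 : ℝ)) ^ 2 * (ctGen d α L κ u p c * ctGen d α L κ' u' p c)) +
            (0 : Fin (d + 1) → Fin (d + 1) → (Fin (d + 1) → ℤ) → Fin (d + 1) → (Fin (d + 1) → ℤ) → MKer (d + 1) (Fib d)) α κ u κ' u'))
          x z (Sum.inl β) (Sum.inl β') :=
  fun α κ u κ' u' x z β β' => by
    simpa only [Pi.zero_apply, add_zero, bhKStepAt_zero] using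
      wilsonW₂_bref_ff_canon_bhKAt hτ ho hN c ρ L L α κ κ' u u' x z β β'

/-- [folklore] (hWff) without the residual slot, against the step Hessian at level `0`: the bare term of
`WilsonReflectionContact2.wilsonW₂_bref_ff_canon_bhKAt`, re-typed at `bhKStepAt d ρ L 0` (definitionally `bhKAt d ρ L`). -/
theorem wilsonW₂_letter_ff_canon_step' (hτ : Complete τ) (ho : TrOrthonormal τ) (hN : N ≠ 0) (c : C) (ρ : Fin (d + 1) → ℤ)
    (L : ℕ) [NeZero L] (α κ : Fin (d + 1)) (u : Fin (d + 1) → ℤ) (κ' : Fin (d + 1)) (u' : Fin (d + 1) → ℤ) (x z : Fin (d + 1) → ℤ)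
    (β β' : Fin (d + 1)) :
    wilsonW₂ d ((8 * (N : ℝ) ^ 2)⁻¹ • wsym22 N) κ (bref α κ u) κ' (bref α κ' u') x z (Sum.inl β) (Sum.inl β') =
      ((reflSign α κ * reflSign α κ') • refK (Φ L α)
        (wilsonW₂ d ((8 * (N : ℝ) ^ 2)⁻¹ • wsym22 N) κ u κ' u' +
          conjW (bhKStepAt d ρ L 0) (wilsonA d κ u) (wilsonA d κ' u')
            (diagK fun p c => (-(1 / 2 : ℝ)) * ctGen d α L κ u p c) (diagK fun p c => (-(1 / 2 : ℝ)) * ctGen d α L κ' u' p c)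
            (diagK fun p c => (-(1 / 2 : ℝ)) ^ 2 * (ctGen d α L κ u p c * ctGen d α L κ' u' p c))))
        x z (Sum.inl β) (Sum.inl β') :=
  wilsonW₂_bref_ff_canon_bhKAt hτ ho hN c ρ L L α κ κ' u u' x z β β'

/-! ## §2 (hRWl)/(hRWr)/(hRWc)/(hRWp) at the zero residual -/

/-- [folklore] (hRWl) at `RW := 0`: the zero letter family vanishes on a left multiplier leg. -/
theorem zeroLetter_inr_left :
    ∀ (α κ : Fin (d + 1)) (u : Fin (d + 1) → ℤ) (κ' : Fin (d + 1)) (u' : Fin (d + 1) → ℤ) (x z : Fin (d + 1) → ℤ) (m : Fin (d + 1))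
      (b' : Fib d),
      (0 : Fin (d + 1) → Fin (d + 1) → (Fin (d + 1) → ℤ) → Fin (d + 1) → (Fin (d + 1) → ℤ) → MKer (d + 1) (Fib d)) α κ u κ' u' x z
        (Sum.inr m) b' = 0 :=
  fun _ _ _ _ _ _ _ _ _ => rfl

/-- [folklore] (hRWr) at `RW := 0`: the zero letter family vanishes on a right multiplier leg. -/
theorem zeroLetter_inr_right :
    ∀ (α κ : Fin (d + 1)) (u : Fin (d + 1) → ℤ) (κ' : Fin (d + 1)) (u' : Fin (d + 1) → ℤ) (x z : Fin (d + 1) → ℤ) (a' : Fib d)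
      (m : Fin (d + 1)),
      (0 : Fin (d + 1) → Fin (d + 1) → (Fin (d + 1) → ℤ) → Fin (d + 1) → (Fin (d + 1) → ℤ) → MKer (d + 1) (Fib d)) α κ u κ' u' x z
        a' (Sum.inr m) = 0 :=
  fun _ _ _ _ _ _ _ _ _ => rfl

/-- [folklore] (hRWc) at `RW := 0`: every slice of the zero letter family is a local bi-stencil family, constant `0`, rate `1`. -/
theorem zeroLetter_locStencil₂ :
    ∀ α : Fin (d + 1), ∃ C δ : ℝ, 0 < δ ∧
      LocStencil₂ ((0 : Fin (d + 1) → Fin (d + 1) → (Fin (d + 1) → ℤ) → Fin (d + 1) → (Fin (d + 1) → ℤ) → MKer (d + 1) (Fib d)) α)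
        C δ :=
  fun _ => ⟨0, 1, one_pos, fun κ u κ' u' => by simpa using (biLoc_zero u u (1 : ℝ) : BiLoc (0 : MKer (d + 1) (Fib d)) u u 0 1)⟩

/-- [folklore] (hRWp) at `RW := 0`: every member of the zero letter family is row-parity-odd. -/
theorem zeroLetter_parityOdd :
    ∀ (α κ : Fin (d + 1)) (u : Fin (d + 1) → ℤ) (κ' : Fin (d + 1)) (u' : Fin (d + 1) → ℤ),
      trK ((0 : Fin (d + 1) → Fin (d + 1) → (Fin (d + 1) → ℤ) → Fin (d + 1) → (Fin (d + 1) → ℤ) → MKer (d + 1) (Fib d)) α κ u κ' u') =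
        -sgnK ((0 : Fin (d + 1) → Fin (d + 1) → (Fin (d + 1) → ℤ) → Fin (d + 1) → (Fin (d + 1) → ℤ) → MKer (d + 1) (Fib d))
          α κ u κ' u') :=
  fun _ _ _ _ _ => parityOdd_zero

end Summit.QuantumFields.BalabanUV.Beta.WilsonLetterSocketFit
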